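import Summits.Schanuel.Schanuel.Theorems.RootDecomp1BResFrame01

/-!
# RootDecomp1BResFrame — lens 4, generation 45 «RESULTANT CLEARING: t(1, ρ) = 5 IN EVERY DEGREE» (lane (d) of B-R26/B-R31 (ii); CHECKLIST B-g41 L2128 taken up verbatim, CLAIM L2306, ACK L2307, NODE ≈L2316–L2319; critic VERDICT pending at staging — filed only on GO) — continuation (RootDecomp1BResFrame02): §E0 the resultant resX0 + §R growth/endgame

(lens-4 g45 HOME kernel K = HOME/decomp-schanuel-lens-4/g45/ResFrame.lean 9524d315…, 978 l, imports tree `…RootDecomp1BAlgFrame09` + `…RootDecomp1KHyper47`; P ResFrameProbe.lean, C ResFrameCtrl.lean (rc 1 = 17 planted), NODE-g45.md. Port by census-1 gen 19 as `RootDecomp1BResFrame01–04`: 01 = §D the class `AlgUltraLiouvilleIrr` (β ≠ ρ, f irreducible over ℚ, unbounded degree, rate exp(−exp(A^m))) + `algUltraLiouville_sqrt_two` + §A plumbing (first-variable splitting `finSuccEquiv` over ℤ) + §B column-wise Leibniz bounds / Sylvester matrix (`resultant_bounds_cols`); 02 = §E0 the resultant `resX0` eliminating X₀ (`aeval_resX0`,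 `resX0_ne_zero` via `aeval_eq_zero_of_conj_irrQ`, `resX0_bounds`) + §R growth (`kappa1`, `royC_le_exp`, `endgame₄₀`, `Gamma`); 03 = §E THE ENGINE `algebraicIndependent_cons_of_algUltraIrr (hRoy : Roy2014_thm_1_1) (hρ : AlgUltraLiouvilleIrr ρ) : AlgebraicIndependent ℚ (ρ, e, e^ρ, e^i, e^{iρ})` (scoped `maxHeartbeats 1600000` as in K); 04 = §C cells `five_le_polarDeg_one_of_algUltraIrr (hRoy) (hρ) : ((5 : ℕ) : Cardinal) ≤ polarDeg ![(1 : ℝ), ρ]`, swap, surplus/KleinPolar bodies, the four At-cells + §M the named member: `irreducible_fSeq_map`, `algUltraLiouvilleIrr_rhoA` HYP-FREE, `five_le_polarDeg_one_rhoA (hRoy)`, `rhoA_position_irr` — mod `Roy2014_thm_1_1` ONLY (registered, unproved ⇒ binder stays).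
PORT EDITS: the class def's docstring tagged «[class] definition …»; three generic helpers private (`mem_roots_map_iff` — known dedup twin —, `ringHom_mvaeval_int`, `coeff_map_algebraMap_mv`) with per-part private copies; four one-line docstrings added; linter option dropped; statements and proofs verbatim. `--supports stmt-Schanuel-24622`; no census credit carried; rung 0 — nothing here proves Schanuel.)
-/

noncomputable section

open Complex IntermediateField MvPolynomial

namespace Summit.Schanuel.Schanuel.Theorems.RootDecomp1BResFrame

open Summit.Schanuel.Schanuel.Theorems.RootDecomp1EPointTransfer (Roy2014_thm_1_1)
open Summit.Schanuel.Schanuel.Theorems.RootDecomp1KHyper (mvlen mvlen_nonneg abs_coeff_le_mvlen one_le_mvlen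
  exists_ball_eval_ne_zero mvlen_add_le mvlen_mul_le mvlen_C_mul_le mvlen_sum_le mvlen_prod_le mvlen_C mvlen_zero)
open Summit.Schanuel.Schanuel.Theorems.RootDecomp1BHyperFrame (royS framePt Ff Ff_eq_aeval exists_lipschitz_Ff gcoef
  gcoef_ne_zero apply_zero_le_totalDegree linearIndependent_one_irrational)
open Summit.Schanuel.Schanuel.Theorems.RootDecomp1BQuadFrame (qy qe qpt qpt_apply framePt_qy_qe linearIndependent_qpt
  QuadHyperLiouville norm_exp_qpt_le)
open Summit.Schanuel.Schanuel.Theorems.RootDecomp1BAlgFrame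
open Summit.Schanuel.Schanuel.Theorems.RootDecomp1BFedFlagCore (KleinIH polarDeg polarField)
open Summit.Schanuel.Schanuel.Theorems.RootDecomp1BDefectFloorDefs (SharpRelativeLindemannAt TameDefectZeroAt
  WildSharpDefectZeroAt WildSharpDefectZeroInitAt WildSharpInitAt)
open Summit.Schanuel.Schanuel.Theorems.RootDecomp1BDefectFloorCells (natCast_le_trdeg_of_algebraicIndependent)
open Summit.Schanuel.Schanuel.Theorems.RootDecomp1BRadicalDescent (exists_int_relation norm_mvaeval_le_mvlen)
open Summit.Schanuel.Schanuel.Theorems.RootDecomp1BMovingZero (mem_polarField_one mem_polarField_swap)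

/-! ## §E0  The resultant `N = Res_{X₀}(f, P)`: definition, product formula, non-vanishing, size -/

section Resultant

variable {n : ℕ}

/-- **THE CLEARED RELATION** `resX0 f P := Res_{X₀}(f, P) ∈ ℤ[X₁..Xₙ]` — Mathlib's Sylvester resultant over the
ring `ℤ[X₁..Xₙ]` of `f` (constant coefficients) and `P̂ = finSuccEquiv ℤ n P` (the relation as a polynomial in `X₀`),
in the degrees `m := f.natDegree`, `n := P̂.natDegree` (`= degreeOf 0 P`, Mathlib `natDegree_finSuccEquiv`). -/
def resX0 (f : Polynomial ℤ) (P : MvPolynomial (Fin (n + 1)) ℤ) : MvPolynomial (Fin n) ℤ :=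
  Polynomial.resultant (f.map (algebraMap ℤ (MvPolynomial (Fin n) ℤ))) (finSuccEquiv ℤ n P)
    f.natDegree (finSuccEquiv ℤ n P).natDegree

/-- **PRODUCT FORMULA = NORM FORM**: `N(θ) = lead(f)^{D₀} · ∏_{γ ∈ roots of f in ℂ} P(γ, θ)` (roots as a multiset;
Mathlib `resultant_map_map` + `resultant_eq_prod_eval`, `f` splits in `ℂ`). -/
theorem aeval_resX0 (f : Polynomial ℤ) (P : MvPolynomial (Fin (n + 1)) ℤ) (θ : Fin n → ℂ) :
    aeval θ (resX0 f P) = (f.map (algebraMap ℤ ℂ)).leadingCoeff ^ (finSuccEquiv ℤ n P).natDegree *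
      ((f.map (algebraMap ℤ ℂ)).roots.map fun γ => aeval (Fin.cons γ θ : Fin (n + 1) → ℂ) P).prod := by
  set fC : Polynomial ℂ := f.map (algebraMap ℤ ℂ) with hfC
  set G := finSuccEquiv ℤ n P with hG
  have h1 : (MvPolynomial.aeval θ).toRingHom (resX0 f P) =
      Polynomial.resultant ((f.map (algebraMap ℤ (MvPolynomial (Fin n) ℤ))).map (MvPolynomial.aeval θ).toRingHom)
        (G.map (MvPolynomial.aeval θ).toRingHom) f.natDegree G.natDegree := by
    rw [resX0, Polynomial.resultant_map_map]
  have h2 : (f.map (algebraMap ℤ (MvPolynomial (Fin n) ℤ))).map (MvPolynomial.aeval θ).toRingHom = fC := by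
    rw [Polynomial.map_map, hfC]
    congr 1
    exact RingHom.ext_int _ _
  have hd : f.natDegree = fC.natDegree :=
    (Polynomial.natDegree_map_eq_of_injective (algebraMap ℤ ℂ).injective_int f).symm
  have h3 : (G.map (MvPolynomial.aeval θ).toRingHom).natDegree ≤ G.natDegree := Polynomial.natDegree_map_le
  have h4 := Polynomial.resultant_eq_prod_eval fC (G.map (MvPolynomial.aeval θ).toRingHom) G.natDegree h3
    (IsAlgClosed.splits fC)
  have h5 : fC.roots.map (fun r => (G.map (MvPolynomial.aeval θ).toRingHom).eval r) =
      fC.roots.map fun γ => aeval (Fin.cons γ θ : Fin (n + 1) → ℂ) P :=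
    Multiset.map_congr rfl fun r _ => by rw [hG, ← aeval_cons_eq_eval_finSuccEquiv]
  change (MvPolynomial.aeval θ).toRingHom (resX0 f P) = _
  rw [h1, h2, hd, h4, h5]

/-- Membership in the root multiset of `f` over `ℂ`. -/
private theorem mem_roots_map_iff {f : Polynomial ℤ} (hf : f ≠ 0) (r : ℂ) :
    r ∈ (f.map (algebraMap ℤ ℂ)).roots ↔ Polynomial.aeval r f = 0 := by
  have hfC0 : f.map (algebraMap ℤ ℂ) ≠ 0 := (Polynomial.map_ne_zero_iff (algebraMap ℤ ℂ).injective_int).mpr hf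
  rw [Polynomial.mem_roots hfC0, Polynomial.IsRoot.def, Polynomial.eval_map, ← Polynomial.aeval_def]

/-- The SPECIALISATION `Φ_γ = P(γ, X₁..Xₙ) ∈ ℂ[X₁..Xₙ]` of the first variable at a complex number `γ`. -/
def PhiSpec (P : MvPolynomial (Fin (n + 1)) ℤ) (γ : ℂ) : MvPolynomial (Fin n) ℂ :=
  ∑ s ∈ P.support, monomial (Finsupp.tail s) (((P.coeff s : ℤ) : ℂ) * γ ^ (s 0))

/-- `Φ_γ(θ) = P(γ, θ)`. -/
theorem eval_PhiSpec (P : MvPolynomial (Fin (n + 1)) ℤ) (γ : ℂ) (θ : Fin n → ℂ) :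
    eval θ (PhiSpec P γ) = aeval (Fin.cons γ θ : Fin (n + 1) → ℂ) P := by
  unfold PhiSpec
  rw [map_sum]
  conv_rhs => rw [MvPolynomial.aeval_def, MvPolynomial.eval₂_eq']
  refine Finset.sum_congr rfl fun s _ => ?_
  rw [MvPolynomial.eval_monomial, Finsupp.prod_fintype _ _ (fun _ => by simp), Fin.prod_univ_succ]
  simp only [Finsupp.tail_apply, Fin.cons_zero, Fin.cons_succ, algebraMap_int_eq, eq_intCast]
  ring

/-- The coefficients of `Φ_γ` are the values `g_{s'}(γ)` of the tree's grouped coefficients `gcoef P s' ∈ ℤ[Y]`. -/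
theorem coeff_PhiSpec (P : MvPolynomial (Fin (n + 1)) ℤ) (γ : ℂ) (s' : Fin n →₀ ℕ) :
    MvPolynomial.coeff s' (PhiSpec P γ) = ((gcoef P s').map (Int.castRingHom ℂ)).eval γ := by
  classical
  unfold PhiSpec gcoef
  rw [MvPolynomial.coeff_sum, Polynomial.eval_map, Polynomial.eval₂_finsetSum,
    ← Finset.sum_filter_add_sum_filter_not P.support (fun s => Finsupp.tail s = s')]
  rw [Finset.sum_eq_zero (s := P.support.filter fun s => ¬ Finsupp.tail s = s') (fun s hs => by
        rw [MvPolynomial.coeff_monomial, if_neg (Finset.mem_filter.mp hs).2]), add_zero]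
  refine Finset.sum_congr rfl fun s hs => ?_
  rw [MvPolynomial.coeff_monomial, if_pos (Finset.mem_filter.mp hs).2, Polynomial.eval₂_monomial]
  simp only [eq_intCast]

/-- **CONJUGATION** for an integer polynomial irreducible over `ℚ` (not necessarily monic): an integer polynomial
vanishing at one complex root of `f` vanishes at every complex root of `f`. -/
theorem aeval_eq_zero_of_conj_irrQ {f : Polynomial ℤ} (hirr : Irreducible (f.map (Int.castRingHom ℚ))) {r ω : ℂ}
    (hr : Polynomial.aeval r f = 0) (hω : Polynomial.aeval ω f = 0) {g : Polynomial ℤ}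
    (hg : Polynomial.aeval r g = 0) : Polynomial.aeval ω g = 0 := by
  set fQ : Polynomial ℚ := f.map (algebraMap ℤ ℚ) with hfQ
  have hfQ' : fQ = f.map (Int.castRingHom ℚ) := by rw [hfQ, algebraMap_int_eq]
  have hirrQ : Irreducible fQ := by rw [hfQ']; exact hirr
  have hrQ : Polynomial.aeval r fQ = 0 := by rw [hfQ, Polynomial.aeval_map_algebraMap]; exact hr
  have hωQ : Polynomial.aeval ω fQ = 0 := by rw [hfQ, Polynomial.aeval_map_algebraMap]; exact hω
  have h1 : fQ * Polynomial.C fQ.leadingCoeff⁻¹ = minpoly ℚ r := minpoly.eq_of_irreducible hirrQ hrQ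
  have h2 : fQ * Polynomial.C fQ.leadingCoeff⁻¹ = minpoly ℚ ω := minpoly.eq_of_irreducible hirrQ hωQ
  have hgQ : Polynomial.aeval r (g.map (algebraMap ℤ ℚ)) = 0 := by
    rw [Polynomial.aeval_map_algebraMap]; exact hg
  have hdvd : minpoly ℚ r ∣ g.map (algebraMap ℤ ℚ) := minpoly.dvd ℚ r hgQ
  rw [← h1, h2] at hdvd
  have h3 := Polynomial.aeval_eq_zero_of_dvd_aeval_eq_zero hdvd (minpoly.aeval ℚ ω)
  rwa [Polynomial.aeval_map_algebraMap] at h3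

/-- **`N ≠ 0`.**  If `f` is irreducible over `ℚ` with root `β`, and SOME grouped coefficient `g_{s₀'}` of `P` does
not vanish at `β` (in the engine: `s₀ ∈ supp P`, `β ≠ ρ` in the punctured ball where `g_{tail s₀}` has no zero), then
`Res_{X₀}(f, P) ≠ 0`: otherwise the product formula at EVERY `θ ∈ ℂⁿ` and `MvPolynomial.funext` make some conjugate
factor `Φ_γ = P(γ, ·)` vanish identically, so every `g_{s'}(γ) = 0`, hence (conjugation) every `g_{s'}(β) = 0`. -/
theorem resX0_ne_zero {f : Polynomial ℤ} (hirr : Irreducible (f.map (Int.castRingHom ℚ))) {β : ℂ}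
    (hβ : Polynomial.aeval β f = 0) (P : MvPolynomial (Fin (n + 1)) ℤ) {s₀' : Fin n →₀ ℕ}
    (hg : ((gcoef P s₀').map (Int.castRingHom ℂ)).eval β ≠ 0) : resX0 f P ≠ 0 := by
  classical
  intro hN
  have hf0 : f ≠ 0 := fun hf => hirr.ne_zero (by rw [hf, Polynomial.map_zero])
  set fC : Polynomial ℂ := f.map (algebraMap ℤ ℂ) with hfC
  have hlead : fC.leadingCoeff ≠ 0 := by
    rw [hfC, Polynomial.leadingCoeff_map_of_injective (algebraMap ℤ ℂ).injective_int, Ne,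
      map_eq_zero_iff _ (algebraMap ℤ ℂ).injective_int, Polynomial.leadingCoeff_eq_zero]
    exact hf0
  -- the product of the specialisations vanishes identically
  have hprod0 : (fC.roots.map (PhiSpec P)).prod = 0 := by
    apply MvPolynomial.funext
    intro θ
    rw [map_zero, map_multiset_prod, Multiset.map_map]
    have h1 : fC.roots.map ((MvPolynomial.eval θ) ∘ PhiSpec P) =
        fC.roots.map fun γ => aeval (Fin.cons γ θ : Fin (n + 1) → ℂ) P :=
      Multiset.map_congr rfl fun γ _ => eval_PhiSpec P γ θ
    have h2 := aeval_resX0 f P θ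
    rw [hN, map_zero] at h2
    rw [h1]
    rcases mul_eq_zero.mp h2.symm with h3 | h3
    · exact absurd (pow_eq_zero_iff'.mp h3).1 hlead
    · exact h3
  obtain ⟨γ, hγ, hΦ⟩ : ∃ γ ∈ fC.roots, PhiSpec P γ = 0 := by
    have h0 : (0 : MvPolynomial (Fin n) ℂ) ∈ fC.roots.map (PhiSpec P) := Multiset.prod_eq_zero_iff.mp hprod0
    obtain ⟨γ, hγ, h⟩ := Multiset.mem_map.mp h0
    exact ⟨γ, hγ, h⟩
  have hγf : Polynomial.aeval γ f = 0 := (mem_roots_map_iff hf0 γ).mp hγ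
  -- every grouped coefficient vanishes at `γ`, hence at `β`
  have hgγ : Polynomial.aeval γ (gcoef P s₀') = 0 := by
    have h := coeff_PhiSpec P γ s₀'
    rw [hΦ, MvPolynomial.coeff_zero] at h
    rw [Polynomial.aeval_def, algebraMap_int_eq, ← Polynomial.eval_map]
    exact h.symm
  have hgβ : Polynomial.aeval β (gcoef P s₀') = 0 := aeval_eq_zero_of_conj_irrQ hirr hγf hβ hgγ
  rw [Polynomial.aeval_def, algebraMap_int_eq, ← Polynomial.eval_map] at hgβ
  exact hg hgβ

/-- The coefficients of `f` seen in `ℤ[x⃗][X₀]` are the constants `C (f.coeff t)`. -/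
private theorem coeff_map_algebraMap_mv (f : Polynomial ℤ) (t : ℕ) :
    (f.map (algebraMap ℤ (MvPolynomial (Fin n) ℤ))).coeff t = MvPolynomial.C (f.coeff t) := by
  rw [Polynomial.coeff_map, MvPolynomial.algebraMap_eq]

/-- **SIZE of the cleared relation** (column-wise Leibniz on the Sylvester determinant: `d = deg f` columns of
`P̂`-coefficients of length `≤ L = len P` and degree `≤ D = deg P`, `D₀` columns of constants `≤ A`):
`len N ≤ (d + D₀)!·L^d·A^{D₀}` and `deg N ≤ d·D`. -/
theorem resX0_bounds (f : Polynomial ℤ) (P : MvPolynomial (Fin (n + 1)) ℤ) {A : ℕ}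
    (hfA : ∀ i, |f.coeff i| ≤ (A : ℤ)) :
    mvlen (resX0 f P) ≤ (Nat.factorial (f.natDegree + (finSuccEquiv ℤ n P).natDegree) : ℤ) *
        (mvlen P ^ f.natDegree * (A : ℤ) ^ (finSuccEquiv ℤ n P).natDegree) ∧
      (resX0 f P).totalDegree ≤ f.natDegree * P.totalDegree := by
  have hA0 : (0 : ℤ) ≤ A := by positivity
  have hf : ∀ t, mvlen ((f.map (algebraMap ℤ (MvPolynomial (Fin n) ℤ))).coeff t) ≤ (A : ℤ) ∧
      ((f.map (algebraMap ℤ (MvPolynomial (Fin n) ℤ))).coeff t).totalDegree ≤ 0 := fun t => by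
    rw [coeff_map_algebraMap_mv]
    exact ⟨by rw [mvlen_C]; exact hfA t, by rw [MvPolynomial.totalDegree_C]⟩
  have hg : ∀ t, mvlen ((finSuccEquiv ℤ n P).coeff t) ≤ mvlen P ∧
      ((finSuccEquiv ℤ n P).coeff t).totalDegree ≤ P.totalDegree := fun t =>
    ⟨mvlen_coeff_finSuccEquiv_le P t, totalDegree_coeff_finSuccEquiv_le P t⟩
  have h := resultant_bounds_cols (f.map (algebraMap ℤ (MvPolynomial (Fin n) ℤ))) (finSuccEquiv ℤ n P)
    f.natDegree (finSuccEquiv ℤ n P).natDegree hA0 (mvlen_nonneg P) hf hg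
  unfold resX0
  exact ⟨h.1, h.2.trans (by omega)⟩

end Resultant

/-! ## §R  The growth of Roy's degree-dependent constant and the endgame -/

section Growth

/-- The closed-form constant `κ₁ := 6·1152⁴ + (36·1152⁵)⁸` in `royC n ≤ exp (κ₁ (n+1)^{40})`
(`royS 4 2 (n + 1) = 1152 (n + 1)`). -/
def kappa1 : ℝ := 6 * 1152 ^ 4 + (36 * 1152 ^ 5) ^ 8

/-- `0 ≤ kappa1 D`. -/
theorem kappa1_nonneg : 0 ≤ kappa1 := by unfold kappa1; positivity

/-- The value of `royS` at the frame parameters `(4, 2)`. -/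
theorem royS_four_two (D : ℕ) : royS 4 2 D = 1152 * D := by
  unfold royS
  have h : Nat.factorial 4 = 24 := rfl
  rw [h]

/-- `a + exp b ≤ exp (a + b)` for `a, b ≥ 0`. -/
private theorem add_exp_le_exp_add {a b : ℝ} (ha : 0 ≤ a) (hb : 0 ≤ b) : a + Real.exp b ≤ Real.exp (a + b) := by
  rw [Real.exp_add]
  have h1 : a + 1 ≤ Real.exp a := Real.add_one_le_exp a
  have h2 : 1 ≤ Real.exp b := Real.one_le_exp hb
  nlinarith [Real.exp_pos a, Real.exp_pos b]

/-- **GROWTH OF ROY'S CONSTANT IN THE DEGREE** (closed form): `royC n ≤ exp (κ₁ · (n + 1)^{40})`. -/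
theorem royC_le_exp (n : ℕ) : royC n ≤ Real.exp (kappa1 * ((n : ℝ) + 1) ^ 40) := by
  unfold royC
  rw [royS_four_two]
  push_cast
  set x : ℝ := (n : ℝ) + 1 with hx
  have hx1 : 1 ≤ x := by rw [hx]; linarith [(Nat.cast_nonneg n : (0 : ℝ) ≤ n)]
  have hx0 : 0 ≤ x := le_trans zero_le_one hx1
  have h1 : 6 * (1152 * x) ^ 4 + (36 * (1152 * x) ^ 5) ^ 8 ≤ kappa1 * x ^ 40 := by
    unfold kappa1
    have h4 : x ^ 4 ≤ x ^ 40 := pow_le_pow_right₀ hx1 (by norm_num)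
    have e1 : 6 * (1152 * x) ^ 4 = 6 * 1152 ^ 4 * x ^ 4 := by ring
    have e2 : (36 * (1152 * x) ^ 5) ^ 8 = (36 * 1152 ^ 5) ^ 8 * x ^ 40 := by ring
    rw [e1, e2]
    nlinarith
  calc 6 * (1152 * x) ^ 4 + Real.exp ((36 * (1152 * x) ^ 5) ^ 8)
      ≤ Real.exp (6 * (1152 * x) ^ 4 + (36 * (1152 * x) ^ 5) ^ 8) :=
        add_exp_le_exp_add (by positivity) (by positivity)
    _ ≤ Real.exp (kappa1 * x ^ 40) := Real.exp_le_exp.mpr h1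

/-- **THE ENDGAME**: `c·A^{40} < A^m` once `m ≥ 41 + k`, `2^k > c`, `A ≥ 2`. -/
theorem endgame₄₀ {c : ℝ} {A k m : ℕ} (hk : c < 2 ^ k) (hA : 2 ≤ A) (hm : 41 + k ≤ m) :
    c * (A : ℝ) ^ 40 < (A : ℝ) ^ m := by
  have hA1 : (1 : ℝ) ≤ A := by exact_mod_cast le_trans one_le_two hA
  have hA2 : (2 : ℝ) ≤ A := by exact_mod_cast hA
  have h1 : (2 : ℝ) ^ k ≤ (A : ℝ) ^ k := pow_le_pow_left₀ (by norm_num) hA2 k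
  have h2 : (A : ℝ) ^ k ≤ (A : ℝ) ^ (k + 1) := pow_le_pow_right₀ hA1 (by omega)
  have h3 : (A : ℝ) ^ (41 + k) ≤ (A : ℝ) ^ m := pow_le_pow_right₀ hA1 hm
  have h4 : (A : ℝ) ^ (41 + k) = (A : ℝ) ^ 40 * (A : ℝ) ^ (k + 1) := by rw [← pow_add]; congr 1; omega
  have h40 : (0 : ℝ) < (A : ℝ) ^ 40 := by positivity
  calc c * (A : ℝ) ^ 40 < (A : ℝ) ^ (k + 1) * (A : ℝ) ^ 40 := by
        exact mul_lt_mul_of_pos_right (by linarith) h40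
    _ = (A : ℝ) ^ (41 + k) := by rw [h4, mul_comm]
    _ ≤ (A : ℝ) ^ m := h3

end Growth

end Summit.Schanuel.Schanuel.Theorems.RootDecomp1BResFrame

end
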